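import Summits.RiemannHypothesis.RiemannHypothesis.Theorems.HandoffAnalytic
import Literature.NumberTheory.LFunctions.WeilSemilocalFiniteCodimension
import HarnessLib

/-!
# HANDOFF — the AGGREGATE objects typed (1/2): the semi-local ground energy `λ_min(S; a)`, the aggregate deficit `D_q(b)`, the load `r(q)` (cell rh-explicit, TRACK «HANDOFF», seat theory-2)

HONEST FRAMING. Nothing here proves or approaches RH. HANDOFF-STATEMENT.md (§D, §H.3, §H.6) and conj-1's
MARGIN-LAW / PREREG-H7-H11 speak about AGGREGATE (Rayleigh-bottom) quantities of the SEMI-LOCAL forms — the continuum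
bottom `λ_min(S; t; σ) = inf {Re Q_S(g)/‖g‖₂² : g ∈ C(t)^σ}`, the aggregate deficit `D_q(t) = −λ_min(S_q; t)` of the
`{p < q}`-form, and the LOAD `r(q) = D_q((log q⁺)/2)/cap(q)`, `cap(q) = (log q)/√q` — which so far had no name in the
tree (HANDOFF-STATEMENT §H.7: «NOT typed: the aggregate quantities … junk-value surface»). This file types them with the
junk surface handled exactly as for the tree's `weilGroundEnergy` (`WeilGroundEnergyParitySplit.lean`: value sets on the
`L²`-unit sphere of a window, `sInf`, empty sphere for `a ≤ 0`), and proves, RH-free: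

* §2 the semi-local value sets are BOUNDED BELOW on every window (Bombieri's §4 Lemma 3 argument + the tree's comparison
  `Re Q ≤ Re Q_S + 4(Σ_{n ≤ e^{2a}} Λ(n)/√n)‖g‖₂²`), NONEMPTY for `a > 0`, MONOTONE in the window
  (`semilocalGroundEnergy_anti`: `t ↦ λ_min(S; t)` is non-increasing for EVERY finite `S` and sector — HANDOFF-STATEMENT
  §H.3 (b), there «not separately typed»);
* §3 homogeneity `Q_S(c g) = |c|² Q_S(g)`, the Rayleigh bound `λ_min(S; a)·‖g‖₂² ≤ Re Q_S(g)`, and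
  `0 ≤ λ_min(S; a) ↔ WeilSemilocalPositivityOn S a ↔ a ≤ a*(S)` — the A4 WALL `a*(S_q)` is exactly where the aggregate
  deficit switches on (`aggregateDeficit_pos_iff`); every finite-section value is a LOWER bound of `D_q`
  (`deficit_le_aggregateDeficit_mul`);
* §4 LOCALITY: below the first missing prime the semi-local bottom IS `ε` (`semilocalGroundEnergy_window`:
  `λ_min(S_{q'}; b; σ) = ε_σ(b)` for `b ≤ (log q')/2`, consecutive `q < q'`; `semilocalGroundEnergy_old_cone`), and
  `H(q) ↔ D_{q'}((log q')/2) ≤ 0`.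

The load `r(q)` (`handoffLoad`) is DEFINED here (§1) and studied in part 2/2 (`HandoffLoadCeiling.lean`): the RH-free sandwich `|ε(b) − λ_min(S_q; b)| ≤ cap(q)` on the window and, under
`H(q)` / RH, `D_q ≤ cap − ε` and `r(q) ≤ 1`.

References (as printed): E. Bombieri, Rend. Mat. Acc. Lincei (9) 11 (2000) §4 Problem 2 (p. 194), Lemma 3, Thm 3, Thm 5 (p. 199)
(`Bombieri2000Weil`); A. Connes, C. Consani, Enseign. Math. 69 (2023) §2.2–2.4 (the smallest eigenvalue of the semi-local form
with and without the new prime; `ConnesConsani2023`); H. Yoshida, Adv. Stud. Pure Math. 21 (1992) Prop. 6 p. 320 (`Yoshida1992HermitianForms`).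
-/

set_option linter.dupNamespace false  -- the mandated namespace repeats `RiemannHypothesis`

noncomputable section

open Set Filter Complex MeasureTheory Literature.NumberTheory.LFunctions
open Summit.RiemannHypothesis.RiemannHypothesis.Theorems.Handoff
open Summit.RiemannHypothesis.RiemannHypothesis.Theorems.HandoffAnalytic
open Summit.RiemannHypothesis.RiemannHypothesis.Theorems.MotivicDoor.SemilocalThreshold
open Summit.RiemannHypothesis.RiemannHypothesis.Theorems.MotivicDoor.Semilocal
open scoped Real ComplexConjugate ArithmeticFunction.vonMangoldt

namespace Summit.RiemannHypothesis.RiemannHypothesis.Theorems.HandoffSemilocalEnergy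

variable {g : ℝ → ℂ} {S : Finset ℕ} {P : (ℝ → ℂ) → Prop} {a b x : ℝ} {q q' : ℕ}

/-! ## §1  The objects -/

/-- The values `Re Q_S(g)` over the `L²`-unit sphere of Weil test functions on the window `[−a, a]` subject to a
constraint `P` (a sector, or nothing): the semi-local twin of the tree's `weilWindowSphereValues`. [cite: Bombieri2000Weil, §4 Problem 2 (p. 194), with the primes restricted to S] -/
def semilocalSphereValues (S : Finset ℕ) (P : (ℝ → ℂ) → Prop) (a : ℝ) : Set ℝ :=
  {x : ℝ | ∃ g : ℝ → ℂ, IsWeilTest g ∧ tsupport g ⊆ Icc (-a) a ∧ P g ∧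
    ∫ t : ℝ, ‖g t‖ ^ 2 = 1 ∧ x = (weilSemilocalQuadratic S g).re}

/-- **The semi-local ground energy** `λ_min(S; a; P) := inf {Re Q_S(g) : g ∈ C(a), P g, ‖g‖₂ = 1}` — the continuum
bottom of the `S ∪ {∞}` form on the window (CC 2023 §2.2–2.4 plot its finite-section values «with and without» a prime;
HANDOFF-STATEMENT §H.3). DEFINITION ONLY: a real `sInf` (junk value `0` for `a ≤ 0`, empty sphere); bounded below
(`bddBelow_semilocalSphereValues`). [cite: ConnesConsani2023, §2.2–2.4 (smallest eigenvalue of the semi-local quadratic form); Bombieri2000Weil §4 Problem 2] -/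
def semilocalGroundEnergy (S : Finset ℕ) (P : (ℝ → ℂ) → Prop) (a : ℝ) : ℝ :=
  sInf (semilocalSphereValues S P a)

/-- **The aggregate deficit** of the `{p < q}`-form on `C(b)`: `D_q(b) := −λ_min(S_q; b)` (all sectors), `S_q = primesBelow q`
— the supremum of `deficit q g/‖g‖₂²` (HANDOFF-STATEMENT §D; conj-1's `D_q` without `max(0,·)`). [this track, HANDOFF-STATEMENT §D] -/
def aggregateDeficit (q : ℕ) (b : ℝ) : ℝ :=
  -semilocalGroundEnergy (Nat.primesBelow q) (fun _ ↦ True) b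

/-- **The load** of the window of the consecutive primes `q < q'`: `r(q) := D_q((log q')/2)/cap(q)`, `cap(q) = (log q)/√q`
(conj-1's sealed object, PREREG-H7-H11; HANDOFF-STATEMENT §D.5/§E-3). [this track, MARGIN-LAW / PREREG-H7-H11] -/
def handoffLoad (q q' : ℕ) : ℝ :=
  aggregateDeficit q (Real.log q' / 2) / (Real.log q / Real.sqrt q)


/-! ## §2  Bounded below, empty/nonempty, monotone in the window -/

/-- **Every semi-local form is bounded below on every window**: for `tsupport g ⊆ [−a, a]`,
`Re Q_S(g) ≥ C_S(a)·‖g‖₂²` with `C_S(a) = −2(sinh a − a) − 6 Σ_{n ≤ e^{2a}} Λ(n)/√n + ψ(1/4) − log π`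
(Bombieri's constant for the full form, `weilQuadratic_re_ge_of_tsupport_subset`, minus the tree's comparison
`Re Q ≤ Re Q_S + 4(Σ Λ(n)/√n)‖g‖₂²`). [cite: Bombieri2000Weil, §4 Lemma 3 and Thm 3 (proof), primes restricted to S] -/
theorem re_weilSemilocalQuadratic_ge_of_tsupport_subset (S : Finset ℕ) (hg : IsWeilTest g)
    (hsupp : tsupport g ⊆ Icc (-a) a) :
    (-(2 * (Real.sinh a - a))
        - 6 * (∑ n ∈ Finset.range (⌊Real.exp (2 * a)⌋₊ + 1), (Λ n : ℝ) / Real.sqrt n)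
        + ((Complex.digamma (1 / 4)).re - Real.log π)) * (∫ t : ℝ, ‖g t‖ ^ 2) ≤
      (weilSemilocalQuadratic S g).re := by
  have h1 := weilQuadratic_re_ge_of_tsupport_subset hg hsupp
  have h2 := weilQuadratic_re_le_weilSemilocalQuadratic_re_add S hg hsupp
  linarith

/-- The semi-local value sets are bounded below. [cite: Bombieri2000Weil, §4 Thm 3 (proof: "bounded below in L²(E)"), primes restricted to S] -/
theorem bddBelow_semilocalSphereValues (S : Finset ℕ) (P : (ℝ → ℂ) → Prop) (a : ℝ) :
    BddBelow (semilocalSphereValues S P a) := by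
  refine ⟨-(2 * (Real.sinh a - a))
      - 6 * (∑ n ∈ Finset.range (⌊Real.exp (2 * a)⌋₊ + 1), (Λ n : ℝ) / Real.sqrt n)
      + ((Complex.digamma (1 / 4)).re - Real.log π), ?_⟩
  rintro x ⟨g, hg, hsupp, -, hnorm, rfl⟩
  have h := re_weilSemilocalQuadratic_ge_of_tsupport_subset S hg hsupp
  rwa [hnorm, mul_one] at h

/-- The value sets increase with the window. [folklore] -/
theorem semilocalSphereValues_mono (S : Finset ℕ) (P : (ℝ → ℂ) → Prop) (hba : b ≤ a) :
    semilocalSphereValues S P b ⊆ semilocalSphereValues S P a := by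
  rintro x ⟨g, hg, hs, hP, hn, hx⟩
  exact ⟨g, hg, hs.trans (Icc_subset_Icc (neg_le_neg hba) hba), hP, hn, hx⟩

/-- The elements of the semi-local value set and of the tree's `weilWindowSphereValues` are indexed by the SAME test
functions; in particular one is nonempty iff the other is. [folklore] -/
theorem semilocalSphereValues_nonempty_iff (S : Finset ℕ) (P : (ℝ → ℂ) → Prop) (a : ℝ) :
    (semilocalSphereValues S P a).Nonempty ↔ (weilWindowSphereValues P a).Nonempty := by
  constructor
  · rintro ⟨x, g, hg, hs, hP, hn, -⟩
    exact ⟨_, g, hg, hs, hP, hn, rfl⟩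
  · rintro ⟨x, g, hg, hs, hP, hn, -⟩
    exact ⟨_, g, hg, hs, hP, hn, rfl⟩

/-- Junk regime: for `a ≤ 0` every value set is empty (a test function supported in a null set has `∫|g|² = 0 ≠ 1`). [folklore] -/
theorem semilocalSphereValues_eq_empty (S : Finset ℕ) (P : (ℝ → ℂ) → Prop) (ha : a ≤ 0) :
    semilocalSphereValues S P a = ∅ := by
  rcases (semilocalSphereValues S P a).eq_empty_or_nonempty with h | h
  · exact h
  · have h' := (semilocalSphereValues_nonempty_iff S P a).1 h
    rw [weilWindowSphereValues_eq_empty P ha] at h'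
    exact absurd h' Set.not_nonempty_empty

/-- Hence `λ_min(S; a; P) = 0` (junk) for `a ≤ 0`. [folklore] -/
theorem semilocalGroundEnergy_of_nonpos (S : Finset ℕ) (P : (ℝ → ℂ) → Prop) (ha : a ≤ 0) :
    semilocalGroundEnergy S P a = 0 := by
  rw [semilocalGroundEnergy, semilocalSphereValues_eq_empty S P ha, Real.sInf_empty]

/-- The unconstrained semi-local sphere of a window `a > 0` is nonempty. [folklore] -/
theorem semilocalSphereValues_top_nonempty (S : Finset ℕ) (ha : 0 < a) :
    (semilocalSphereValues S (fun _ ↦ True) a).Nonempty :=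
  (semilocalSphereValues_nonempty_iff S _ a).2 (weilWindowSphereValues_top_nonempty ha)

/-- The even semi-local sphere of a window `a > 0` is nonempty. [folklore] -/
theorem semilocalSphereValues_even_nonempty (S : Finset ℕ) (ha : 0 < a) :
    (semilocalSphereValues S (fun g ↦ ∀ t, g (-t) = g t) a).Nonempty :=
  (semilocalSphereValues_nonempty_iff S _ a).2 (weilWindowSphereValues_even_nonempty ha)

/-- The odd semi-local sphere of a window `a > 0` is nonempty. [folklore] -/
theorem semilocalSphereValues_odd_nonempty (S : Finset ℕ) (ha : 0 < a) :
    (semilocalSphereValues S (fun g ↦ ∀ t, g (-t) = -g t) a).Nonempty :=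
  (semilocalSphereValues_nonempty_iff S _ a).2 (weilWindowSphereValues_odd_nonempty ha)

/-- **Monotonicity in the window** (HANDOFF-STATEMENT §H.3 (b)): if the smaller window's sphere is nonempty then
`λ_min(S; a; P) ≤ λ_min(S; b; P)` for `b ≤ a` — `t ↦ λ_min(S; t)` is NON-INCREASING, for EVERY finite `S` and every sector
(`C(b) ⊆ C(a)`). [cite: Bombieri2000Weil, §4 Thm 5 (proof, first sentence: "decreasing functions of M"), primes restricted to S] -/
theorem semilocalGroundEnergy_anti (S : Finset ℕ) (P : (ℝ → ℂ) → Prop)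
    (hne : (semilocalSphereValues S P b).Nonempty) (hba : b ≤ a) :
    semilocalGroundEnergy S P a ≤ semilocalGroundEnergy S P b :=
  csInf_le_csInf (bddBelow_semilocalSphereValues S P a) hne (semilocalSphereValues_mono S P hba)

/-- Unconstrained version: `λ_min(S; a) ≤ λ_min(S; b)` for `0 < b ≤ a`. [folklore] -/
theorem semilocalGroundEnergy_top_anti (S : Finset ℕ) (hb : 0 < b) (hba : b ≤ a) :
    semilocalGroundEnergy S (fun _ ↦ True) a ≤ semilocalGroundEnergy S (fun _ ↦ True) b :=
  semilocalGroundEnergy_anti S _ (semilocalSphereValues_top_nonempty S hb) hba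

/-- Elements of the sphere bound the energy from above (Ritz: every section value is an UPPER bound). [folklore] -/
theorem semilocalGroundEnergy_le_re (hg : IsWeilTest g) (hs : tsupport g ⊆ Icc (-a) a) (hP : P g)
    (hn : ∫ t : ℝ, ‖g t‖ ^ 2 = 1) :
    semilocalGroundEnergy S P a ≤ (weilSemilocalQuadratic S g).re :=
  csInf_le (bddBelow_semilocalSphereValues S P a) ⟨g, hg, hs, hP, hn, rfl⟩

/-- A lower bound valid on a nonempty sphere bounds the energy from below (the shape of a K(t)-closure certificate
`μ* ≤ λ_min`). [folklore] -/
theorem le_semilocalGroundEnergy (hne : (semilocalSphereValues S P a).Nonempty)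
    (hb : ∀ g : ℝ → ℂ, IsWeilTest g → tsupport g ⊆ Icc (-a) a → P g →
      ∫ t : ℝ, ‖g t‖ ^ 2 = 1 → x ≤ (weilSemilocalQuadratic S g).re) :
    x ≤ semilocalGroundEnergy S P a := by
  refine le_csInf hne ?_
  rintro y ⟨g, hg, hs, hP, hn, rfl⟩
  exact hb g hg hs hP hn

/-! ## §3  Homogeneity, the Rayleigh bound, and the sign of the energy = the threshold -/

/-- The semi-local functional is linear; in particular `W_S(m k) = m W_S(k)`. [folklore] -/
theorem weilSemilocalFunctional_const_mul (S : Finset ℕ) (m : ℂ) (k : ℝ → ℂ) :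
    weilSemilocalFunctional S (fun t ↦ m * k t) = m * weilSemilocalFunctional S k := by
  have hPr : weilSemilocalPrimeTerm S (fun t ↦ m * k t) = m * weilSemilocalPrimeTerm S k := by
    simp only [weilSemilocalPrimeTerm]
    rw [← tsum_mul_left]
    congr 1 with n
    ring
  have hP : weilPrimeTerm (fun t ↦ m * k t) = m * weilPrimeTerm k := by
    simp only [weilPrimeTerm]
    rw [← tsum_mul_left]
    congr 1 with n
    ring
  rw [weilSemilocalFunctional_eq_weilFunctional_add, weilSemilocalFunctional_eq_weilFunctional_add,
    weilFunctional_const_mul, hPr, hP]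
  ring

/-- **Homogeneity** `Q_S(c g) = |c|² Q_S(g)`. [folklore] -/
theorem weilSemilocalQuadratic_const_mul (S : Finset ℕ) (c : ℂ) (g : ℝ → ℂ) :
    weilSemilocalQuadratic S (fun t ↦ c * g t) = (Complex.normSq c : ℂ) * weilSemilocalQuadratic S g := by
  have hconv : weilConv (fun t ↦ c * g t) (weilReflect fun t ↦ c * g t) =
      fun t ↦ (Complex.normSq c : ℂ) * weilConv g (weilReflect g) t := by
    funext t
    rw [weilConv_apply, weilConv_apply, ← integral_const_mul]
    congr 1 with u
    simp only [weilReflect, map_mul, Complex.normSq_eq_conj_mul_self]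
    ring
  unfold weilSemilocalQuadratic
  rw [hconv, weilSemilocalFunctional_const_mul]

/-- `Q_S(0) = 0`. [folklore] -/
theorem weilSemilocalQuadratic_zero (S : Finset ℕ) : weilSemilocalQuadratic S 0 = 0 := by
  have h := weilSemilocalQuadratic_const_mul S 0 0
  simp only [zero_mul, map_zero, Complex.ofReal_zero] at h
  exact h

/-- **The Rayleigh bound** `λ_min(S; a; P)·‖g‖₂² ≤ Re Q_S(g)` for `g ∈ C(a)` whose positive multiples satisfy `P`
(normalise; `Q_S(c g) = |c|² Q_S(g)`). [cite: Bombieri2000Weil, §4 Problem 2 (λ = T[f*f̄*]/‖f‖²), primes restricted to S] -/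
theorem semilocalGroundEnergy_mul_le_re (hg : IsWeilTest g) (hsupp : tsupport g ⊆ Icc (-a) a)
    (hP : ∀ c : ℝ, 0 < c → P fun t ↦ (c : ℂ) * g t) :
    semilocalGroundEnergy S P a * ∫ t, ‖g t‖ ^ 2 ≤ (weilSemilocalQuadratic S g).re := by
  have hN2nn : 0 ≤ ∫ t : ℝ, ‖g t‖ ^ 2 := integral_nonneg fun _ ↦ by positivity
  rcases hN2nn.eq_or_lt with hz | hpos
  · have hg0 : g = 0 := hg.eq_zero_of_integral_norm_sq_eq_zero hz.symm
    subst hg0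
    rw [weilSemilocalQuadratic_zero, Complex.zero_re, ← hz, mul_zero]
  · set N2 : ℝ := ∫ t : ℝ, ‖g t‖ ^ 2 with hN2
    set c : ℝ := (Real.sqrt N2)⁻¹ with hc
    have hcpos : 0 < c := inv_pos.2 (Real.sqrt_pos.2 hpos)
    have hmem : (weilSemilocalQuadratic S fun t ↦ (c : ℂ) * g t).re ∈ semilocalSphereValues S P a := by
      refine ⟨fun t ↦ (c : ℂ) * g t, hg.const_mul c, tsupport_mul_subset_right.trans hsupp,
        hP c hcpos, ?_, rfl⟩
      simp only [norm_mul, mul_pow, Complex.norm_real, Real.norm_of_nonneg hcpos.le]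
      rw [integral_const_mul, hc, inv_pow, Real.sq_sqrt hN2nn, inv_mul_cancel₀ hpos.ne']
    have hle : semilocalGroundEnergy S P a ≤ (weilSemilocalQuadratic S fun t ↦ (c : ℂ) * g t).re :=
      csInf_le (bddBelow_semilocalSphereValues S P a) hmem
    have hQ' : (weilSemilocalQuadratic S fun t ↦ (c : ℂ) * g t).re = c * c * (weilSemilocalQuadratic S g).re := by
      rw [weilSemilocalQuadratic_const_mul, Complex.normSq_ofReal, Complex.re_ofReal_mul]
    have hcc : c * c * N2 = 1 := by
      rw [hc, ← mul_inv, Real.mul_self_sqrt hN2nn, inv_mul_cancel₀ hpos.ne']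
    have h1 : semilocalGroundEnergy S P a * (c * c * N2) ≤ c * c * (weilSemilocalQuadratic S g).re := by
      rw [hcc, mul_one, ← hQ']
      exact hle
    have h2 : c * c * (semilocalGroundEnergy S P a * N2) ≤ c * c * (weilSemilocalQuadratic S g).re := by
      linarith
    exact le_of_mul_le_mul_left h2 (mul_pos hcpos hcpos)

/-- The energy is `≥ 0` iff `Re Q_S ≥ 0` on all window tests with the (scaling-stable) constraint. [folklore] -/
theorem semilocalGroundEnergy_nonneg_iff
    (hP : ∀ (c : ℝ) (g : ℝ → ℂ), 0 < c → P g → P fun t ↦ (c : ℂ) * g t) :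
    0 ≤ semilocalGroundEnergy S P a ↔
      ∀ g : ℝ → ℂ, IsWeilTest g → tsupport g ⊆ Icc (-a) a → P g → 0 ≤ (weilSemilocalQuadratic S g).re := by
  constructor
  · intro h g hg hs hPg
    have hN : 0 ≤ ∫ t : ℝ, ‖g t‖ ^ 2 := integral_nonneg fun _ ↦ by positivity
    exact (mul_nonneg h hN).trans (semilocalGroundEnergy_mul_le_re hg hs fun c hc ↦ hP c g hc hPg)
  · intro h
    refine Real.sInf_nonneg ?_
    rintro x ⟨g, hg, hs, hPg, -, rfl⟩
    exact h g hg hs hPg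

/-- **`0 ≤ λ_min(S; a) ↔ WeilSemilocalPositivityOn S a`** (all `a`; for `a ≤ 0` both sides hold trivially). [folklore] -/
theorem semilocalGroundEnergy_top_nonneg_iff :
    0 ≤ semilocalGroundEnergy S (fun _ ↦ True) a ↔ WeilSemilocalPositivityOn S a := by
  rw [semilocalGroundEnergy_nonneg_iff fun _ _ _ _ ↦ trivial]
  exact ⟨fun h g hg hs ↦ h g hg hs trivial, fun h g hg hs _ ↦ h g hg hs⟩

/-- **The sign of the bottom is the threshold**: `0 ≤ λ_min(S; a) ↔ a ≤ a*(S)` (`a* = weilSemilocalThreshold`, the cell's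
wall). [cite: Yoshida1992HermitianForms, Prop. 6 (p. 320), with the primes restricted to S] -/
theorem semilocalGroundEnergy_top_nonneg_iff_le_threshold :
    0 ≤ semilocalGroundEnergy S (fun _ ↦ True) a ↔ a ≤ weilSemilocalThreshold S := by
  rw [semilocalGroundEnergy_top_nonneg_iff, weilSemilocalPositivityOn_iff_le_weilSemilocalThreshold]

/-- The aggregate deficit is `≤ 0` exactly on the semi-locally positive windows. [folklore] -/
theorem aggregateDeficit_nonpos_iff : aggregateDeficit q b ≤ 0 ↔ WeilSemilocalPositivityOn (Nat.primesBelow q) b := by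
  rw [aggregateDeficit, neg_nonpos, semilocalGroundEnergy_top_nonneg_iff]

/-- **The wall is where the aggregate deficit switches on**: `0 < D_q(b) ↔ a*(S_q) < b`. [cite: Yoshida1992HermitianForms, Prop. 6 (p. 320), with the primes restricted to S] -/
theorem aggregateDeficit_pos_iff : 0 < aggregateDeficit q b ↔ weilSemilocalThreshold (Nat.primesBelow q) < b := by
  rw [← not_le, aggregateDeficit_nonpos_iff, not_weilSemilocalPositivityOn_iff_weilSemilocalThreshold_lt]

/-- The aggregate deficit is NON-DECREASING in the window (`0 < b ≤ b'`). [folklore] -/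
theorem aggregateDeficit_mono (hb : 0 < b) (hbb' : b ≤ a) : aggregateDeficit q b ≤ aggregateDeficit q a := by
  unfold aggregateDeficit
  exact neg_le_neg (semilocalGroundEnergy_top_anti _ hb hbb')

/-- The Rayleigh form of the aggregate deficit: `deficit q g ≤ D_q(b)·‖g‖₂²` for every `g ∈ C(b)` (so every finite
section value of the cell's engines is a LOWER bound of `D_q`). [folklore] -/
theorem deficit_le_aggregateDeficit_mul (hg : IsWeilTest g) (hsupp : tsupport g ⊆ Icc (-b) b) :
    deficit q g ≤ aggregateDeficit q b * ∫ t, ‖g t‖ ^ 2 := by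
  have h := semilocalGroundEnergy_mul_le_re (S := Nat.primesBelow q) (P := fun _ ↦ True) hg hsupp
    fun _ _ ↦ trivial
  unfold deficit aggregateDeficit
  linarith

/-! ## §4  Locality: below the first missing prime the semi-local bottom is `ε` -/

/-- If every prime power `n ≤ N` has its prime in `S`, the semi-local and the full value sets COINCIDE on every window
`a ≤ (log (N+1))/2` (`Q_S = Q` there). [cite: ConnesConsani2023, §2.1.2 (only the prime powers below λ² enter QW_λ)] -/
theorem semilocalSphereValues_eq_weilWindowSphereValues {N : ℕ}
    (hS : ∀ n ≤ N, IsPrimePow n → n.primeFactors ⊆ S) (ha : a ≤ Real.log ((N : ℝ) + 1) / 2) :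
    semilocalSphereValues S P a = weilWindowSphereValues P a := by
  ext x
  constructor
  · rintro ⟨g, hg, hs, hP, hn, rfl⟩
    exact ⟨g, hg, hs, hP, hn, by
      rw [weilSemilocalQuadratic_eq_weilQuadratic_of_forall hg hS
        (hs.trans (Icc_subset_Icc (neg_le_neg ha) ha))]⟩
  · rintro ⟨g, hg, hs, hP, hn, rfl⟩
    exact ⟨g, hg, hs, hP, hn, by
      rw [weilSemilocalQuadratic_eq_weilQuadratic_of_forall hg hS
        (hs.trans (Icc_subset_Icc (neg_le_neg ha) ha))]⟩

/-- Hence the semi-local energy equals the corresponding restricted ground energy of the full form there. [folklore] -/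
theorem semilocalGroundEnergy_eq_of_forall {N : ℕ}
    (hS : ∀ n ≤ N, IsPrimePow n → n.primeFactors ⊆ S) (ha : a ≤ Real.log ((N : ℝ) + 1) / 2) :
    semilocalGroundEnergy S P a = sInf (weilWindowSphereValues P a) := by
  rw [semilocalGroundEnergy, semilocalSphereValues_eq_weilWindowSphereValues hS ha]

/-- **On the window of consecutive primes `q < q'` the NEW form's bottom is `ε`**: for every sector `P` and
`b ≤ (log q')/2`, `λ_min(S_{q'}; b; P) = sInf (weilWindowSphereValues P b)`. [folklore] -/
theorem semilocalGroundEnergy_window (h : ConsecutivePrimes q q') (P : (ℝ → ℂ) → Prop)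
    (hb : b ≤ Real.log q' / 2) :
    semilocalGroundEnergy (Nat.primesBelow q') P b = sInf (weilWindowSphereValues P b) := by
  rw [h.primesBelow_eq]
  refine semilocalGroundEnergy_eq_of_forall (N := q' - 1)
    (primeFactors_subset_primesBelow_succ_of_gap h.gap) ?_
  rwa [h.cast_pred_add_one]

/-- In particular (all sectors) `λ_min(S_{q'}; b) = ε(b)` for `b ≤ (log q')/2`. [folklore] -/
theorem semilocalGroundEnergy_window_top (h : ConsecutivePrimes q q') (hb : b ≤ Real.log q' / 2) :
    semilocalGroundEnergy (Nat.primesBelow q') (fun _ ↦ True) b = weilGroundEnergy b := by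
  rw [semilocalGroundEnergy_window h _ hb, weilGroundEnergy_eq_sInf]

/-- And on the OLD cone the OLD form's bottom is `ε` too: `λ_min(S_q; b) = ε(b)` for `b ≤ (log q)/2`, `q` prime
(so `D_q(b) = −ε(b)` there: the aggregate deficit below the window is minus Weil's ground energy). [folklore] -/
theorem semilocalGroundEnergy_old_cone (hq : q.Prime) (hb : b ≤ Real.log q / 2) :
    semilocalGroundEnergy (Nat.primesBelow q) (fun _ ↦ True) b = weilGroundEnergy b := by
  have hq1 : 1 ≤ q := hq.one_lt.le
  have hcast : ((q - 1 : ℕ) : ℝ) + 1 = q := by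
    rw [Nat.cast_sub hq1]; push_cast; ring
  have hS : ∀ n ≤ q - 1, IsPrimePow n → n.primeFactors ⊆ Nat.primesBelow q := by
    intro n hn _
    have := primeFactors_subset_primesBelow hn
    rwa [Nat.sub_add_cancel hq1] at this
  rw [semilocalGroundEnergy_eq_of_forall (N := q - 1) hS (by rwa [hcast]), weilGroundEnergy_eq_sInf]

/-- `H(q) ↔ D_{q'}((log q')/2) ≤ 0`: the handoff inequality of `q` says the NEXT form has no aggregate deficit at the
window's end (`= 0 ≤ ε((log q')/2)`). [folklore] -/
theorem handoffH_iff_aggregateDeficit_nonpos (h : ConsecutivePrimes q q') :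
    HandoffH q q' ↔ aggregateDeficit q' (Real.log q' / 2) ≤ 0 := by
  rw [aggregateDeficit_nonpos_iff, handoffH_iff_weilSemilocalPositivityOn h]

end Summit.RiemannHypothesis.RiemannHypothesis.Theorems.HandoffSemilocalEnergy

end
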